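import Summits.MatrixMultiplication.MatrixMultiplication.Theses.LevelGradedCohnUmans

/-!
# `LieEngineLink` — the Lie engine is load-bearing: `LieRankDesigns → GradedDesignFamily`

Route `LevelGradedCohnUmans` (sub-problem `MatrixMultiplication`), support item
stmt-MatrixMultiplication-14050.

Given `ε > 0` and a witness `(p, m, k, X, Y, Z)` of `LieRankDesigns` (a triple in `GL_m(𝔽_p)`
separated by tests of Fourier rank `≤ k`, beating the graded budget `Σ_{χ ∈ Irr ∩ F_k} χ(1)^{2+ε}`),
we produce the witness of `GradedDesignFamily` with

* `G := GL_m(𝔽_p)`;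
* `J := F_k`, the level-`k` Fourier space `{f | ∃ c, (∀ M, k < rk M → c M = 0) ∧ ∀ g, f g =
  Σ_M c_M ψ(tr(M g))}` packaged as a `Submodule ℂ (G → ℂ)` whose carrier is *literally* the set
  appearing in the budget of `LieRankDesigns` (so the two budgets agree definitionally);
* the same `X, Y, Z`.

`F_k` is bi-invariant because `tr(M · a g b) = tr((b M a) · g)` and `rk(b M a) = rk M`
(reindex the Fourier sum by the permutation `M ↦ b M a` of `M_m(𝔽_p)`); the rank-`≤ k`
separators are `F_k`-separators verbatim.  Pure packaging, as the route's planner states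
(BlasiakCohnGrochowPrattUmans2024, Def. 2.1 for the notion of separation).

The reindexing lemmas are adapted from the crux chain's kernel-checked
`Cruxes/LieRankDesigns/Disproof.lean` (`fourierFn_transl`, `rank_transl_arg`), restated against
the inlined clauses of the route decls (no new definitions).
-/

-- single-conjunct summit: the mandated namespace `Summit.MatrixMultiplication.MatrixMultiplication.…`
-- repeats `MatrixMultiplication` (summit = sub-problem), which `linter.dupNamespace` would flag.
set_option linter.dupNamespace false

namespace Summit.MatrixMultiplication.MatrixMultiplication.Theorems

open scoped BigOperators

open Summit.MatrixMultiplication.MatrixMultiplication.Theses.LevelGradedCohnUmans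

section Reindex

variable {p m : ℕ} [Fact p.Prime]

/-- Two-sided multiplication by invertible matrices preserves the rank:
`rk(b N a) = rk N` for `a, b ∈ GL_m(𝔽_p)`. [folklore] -/
theorem lieEngineLink_rank_units_mul (a b : Matrix.GeneralLinearGroup (Fin m) (ZMod p))
    (N : Matrix (Fin m) (Fin m) (ZMod p)) :
    ((b : Matrix (Fin m) (Fin m) (ZMod p)) * N * (a : Matrix (Fin m) (Fin m) (ZMod p))).rank
      = N.rank := by
  have ha : IsUnit (a : Matrix (Fin m) (Fin m) (ZMod p)).det :=
    (Matrix.isUnit_iff_isUnit_det _).mp (Units.isUnit _)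
  have hb : IsUnit (b : Matrix (Fin m) (Fin m) (ZMod p)).det :=
    (Matrix.isUnit_iff_isUnit_det _).mp (Units.isUnit _)
  rw [Matrix.rank_mul_eq_left_of_isUnit_det _ _ ha, Matrix.rank_mul_eq_right_of_isUnit_det _ _ hb]

/-- **Bi-invariance of the Fourier levels** (reindexing): translating the argument of a Fourier
function `g ↦ Σ_M c_M ψ(tr(M g))` by `g ↦ a g b` is the Fourier function of the translated table
`N ↦ c (b⁻¹ N a⁻¹)`, because `tr(M · a g b) = tr((b M a) · g)` and `M ↦ b M a` permutes
`M_m(𝔽_p)`. [folklore] -/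
theorem lieEngineLink_fourier_transl (a b : Matrix.GeneralLinearGroup (Fin m) (ZMod p))
    (c : Matrix (Fin m) (Fin m) (ZMod p) → ℂ) (g : Matrix.GeneralLinearGroup (Fin m) (ZMod p)) :
    (∑ M : Matrix (Fin m) (Fin m) (ZMod p), c M * ZMod.stdAddChar (Matrix.trace
        (M * ((a * g * b : Matrix.GeneralLinearGroup (Fin m) (ZMod p)) :
          Matrix (Fin m) (Fin m) (ZMod p))))) =
      ∑ N : Matrix (Fin m) (Fin m) (ZMod p),
        c (((b⁻¹ : Matrix.GeneralLinearGroup (Fin m) (ZMod p)) : Matrix (Fin m) (Fin m) (ZMod p))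
            * N * ((a⁻¹ : Matrix.GeneralLinearGroup (Fin m) (ZMod p)) :
              Matrix (Fin m) (Fin m) (ZMod p))) *
          ZMod.stdAddChar (Matrix.trace (N * (g : Matrix (Fin m) (Fin m) (ZMod p)))) := by
  refine Fintype.sum_equiv ((Units.mulLeft b).trans (Units.mulRight a)) _ _ fun M => ?_
  simp only [Equiv.trans_apply, Units.mulLeft_apply, Units.mulRight_apply]
  have h1 : ((b⁻¹ : Matrix.GeneralLinearGroup (Fin m) (ZMod p)) : Matrix (Fin m) (Fin m) (ZMod p))
      * ((b : Matrix (Fin m) (Fin m) (ZMod p)) * M * (a : Matrix (Fin m) (Fin m) (ZMod p)))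
      * ((a⁻¹ : Matrix.GeneralLinearGroup (Fin m) (ZMod p)) : Matrix (Fin m) (Fin m) (ZMod p))
      = M := by
    rw [Matrix.mul_assoc (b : Matrix (Fin m) (Fin m) (ZMod p)), Units.inv_mul_cancel_left,
      Units.mul_inv_cancel_right]
  have h2 : Matrix.trace (M * ((a * g * b : Matrix.GeneralLinearGroup (Fin m) (ZMod p)) :
        Matrix (Fin m) (Fin m) (ZMod p))) =
      Matrix.trace ((b : Matrix (Fin m) (Fin m) (ZMod p)) * M * (a : Matrix (Fin m) (Fin m) (ZMod p))
        * (g : Matrix (Fin m) (Fin m) (ZMod p))) := by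
    have hcomm := Matrix.trace_mul_comm (b : Matrix (Fin m) (Fin m) (ZMod p))
      (M * ((a : Matrix (Fin m) (Fin m) (ZMod p)) * (g : Matrix (Fin m) (Fin m) (ZMod p))))
    simp only [Matrix.mul_assoc, Units.val_mul] at hcomm ⊢
    exact hcomm.symm
  rw [h1, h2]

end Reindex

/-- **`LieEngineLink`** (route `LevelGradedCohnUmans`, item stmt-MatrixMultiplication-14050):
the Lie engine is load-bearing, `LieRankDesigns → GradedDesignFamily`.  Take `G := GL_m(𝔽_p)`,
`J := F_k` (the level-`k` Fourier space, as a submodule whose carrier is the budget set of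
`LieRankDesigns`) and the same triple; `F_k` is bi-invariant by `lieEngineLink_fourier_transl`
and `lieEngineLink_rank_units_mul`, the separators are `F_k`-separators verbatim, and the two
budgets coincide. -/
theorem lieEngineLink_proof : LieEngineLink := by
  intro hL ε hε
  obtain ⟨p, hp, m, k, X, Y, Z, hsep, hlt⟩ := hL ε hε
  refine ⟨Matrix.GeneralLinearGroup (Fin m) (ZMod p), inferInstance, inferInstance,
    { carrier := {f | ∃ c : Matrix (Fin m) (Fin m) (ZMod p) → ℂ, (∀ M, k < M.rank → c M = 0) ∧
        ∀ g : Matrix.GeneralLinearGroup (Fin m) (ZMod p), f g =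
          ∑ M : Matrix (Fin m) (Fin m) (ZMod p), c M * ZMod.stdAddChar (Matrix.trace
            (M * (g : Matrix (Fin m) (Fin m) (ZMod p))))}
      add_mem' := by
        rintro f₁ f₂ ⟨c₁, hc₁, hf₁⟩ ⟨c₂, hc₂, hf₂⟩
        refine ⟨c₁ + c₂, fun M hM => ?_, fun g => ?_⟩
        · simp only [Pi.add_apply, hc₁ M hM, hc₂ M hM, add_zero]
        · simp only [Pi.add_apply, hf₁ g, hf₂ g, add_mul, Finset.sum_add_distrib]
      zero_mem' := ⟨0, fun M _ => rfl, fun g => by simp⟩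
      smul_mem' := by
        rintro r f ⟨c, hc, hf⟩
        refine ⟨r • c, fun M hM => ?_, fun g => ?_⟩
        · simp only [Pi.smul_apply, hc M hM, smul_zero]
        · simp only [Pi.smul_apply, smul_eq_mul, hf g, Finset.mul_sum, mul_assoc] },
    X, Y, Z, ?_, ?_, hlt⟩
  · -- bi-invariance of `F_k`
    rintro f ⟨c, hc, hf⟩ a b
    refine ⟨fun N => c (((b⁻¹ : Matrix.GeneralLinearGroup (Fin m) (ZMod p)) :
        Matrix (Fin m) (Fin m) (ZMod p)) * N *
        ((a⁻¹ : Matrix.GeneralLinearGroup (Fin m) (ZMod p)) : Matrix (Fin m) (Fin m) (ZMod p))),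
      fun N hN => hc _ ?_, fun g => ?_⟩
    · rwa [lieEngineLink_rank_units_mul]
    · exact (hf (a * g * b)).trans (lieEngineLink_fourier_transl a b c g)
  · -- separation: the rank-`≤ k` separators are `F_k`-separators verbatim
    intro x₀ hx₀ z₀ hz₀
    obtain ⟨c, hc, hsepc⟩ := hsep x₀ hx₀ z₀ hz₀
    refine ⟨fun g => ∑ M : Matrix (Fin m) (Fin m) (ZMod p), c M * ZMod.stdAddChar (Matrix.trace
        (M * (g : Matrix (Fin m) (Fin m) (ZMod p)))), ⟨c, hc, fun g => rfl⟩,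
      fun x hx y hy y' hy' z hz => ⟨fun h => ?_, fun h => ?_⟩⟩
    · exact (hsepc x hx y hy y' hy' z hz).trans (if_pos h)
    · exact (hsepc x hx y hy y' hy' z hz).trans (if_neg h)

end Summit.MatrixMultiplication.MatrixMultiplication.Theorems
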